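import Mathlib
import Literature.Analysis.FluidPDE.Tao2016AveragedNS.WeightedLatticeFlows
import HarnessLib

/-!
# `HeteroclinicTriggerChain` — crux `TriggerChainFrontStep` (item stmt-NavierStokesRegularity-22785):
  PACKAGING — every weighted lattice solution on `[0,s]` is an exact pseudo-flow on `[0,s]`

The continuation criterion `exists_exact_pseudoFlowOn_of_apriori_bound` (module `WeightedLatticeFlows`)
turns an A PRIORI BOUND for the solutions `T : ℝ → (Fin m × ℤ →ᵇ ℝ)` of the conjugated lattice equation
`T' = F(T)` on the sub-windows `[0,s] ⊆ [0,c]` into the (exist₀)/(front) clause of the certificate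
formats. The dynamical lemmas one wants to use to PROVE such a bound (block/tail energy inequalities,
behind-zone tameness, the hop lemmas of this line) are all stated for `TaoCascade.PseudoFlowOn`. This
file closes the loop: `htcWS_pseudoFlowOn_of_solution` — for admissible weights with the decay constant
`(1 + (1+ε₀)^{10k})/w_k ≤ D`, EVERY solution `T` on `[0,s]` (`0 < s`) is, in the unweighted variables
`S_{i,k} = T_{i,k}/w_k`, an EXACT pseudo-flow `PseudoFlowOn s ε₀ α 0 0 S₀ (½S₀²) 0 S (½S²)` (no bound is
assumed: the qualitative a priori regularity (4.5) comes from continuity on the compact window). So inside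
the a priori argument of DYN-EXIST every `PseudoFlowOn` lemma of the tree applies to the partial solution.
Also `htcWS_norm_le_of_pseudoFlowOn_bound`, the converse bookkeeping `w_k|S_{i,k}| ≤ B ⇒ ‖T‖ ≤ B`.

HONEST FRAMING: calculus bookkeeping for Tao-type MODEL lattice flows (Tao 2016 §4, Lemma 4.1 displays);
helper for the crux, no stub credit; nothing here is a statement about the Navier–Stokes equations; no
summit, rung or crux is proved by this file.
-/

noncomputable section

set_option linter.dupNamespace false

namespace Summit.NavierStokesRegularity.NavierStokesRegularity.Theorems

open Set Metric Filter Topology BoundedContinuousFunction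
open Literature.Analysis.FluidPDE Literature.Analysis.FluidPDE.TaoCascade

/-- `C¹` on a compact interval from a derivative within it that is continuous there. [folklore] -/
theorem htcWS_contDiffOn_one_Icc {f f' : ℝ → ℝ} {a b : ℝ} (hab : a < b)
    (hf : ∀ t ∈ Icc a b, HasDerivWithinAt f (f' t) (Icc a b) t) (hf' : ContinuousOn f' (Icc a b)) :
    ContDiffOn ℝ 1 f (Icc a b) := by
  rw [show (1 : WithTop ℕ∞) = 0 + 1 from (zero_add 1).symm,
    contDiffOn_succ_iff_derivWithin (uniqueDiffOn_Icc hab)]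
  refine ⟨fun t ht => (hf t ht).differentiableWithinAt, fun h => absurd h (by simp), ?_⟩
  exact contDiffOn_zero.2
    (hf'.congr fun t ht => (hf t ht).derivWithin (uniqueDiffOn_Icc hab t ht))

/-- **Every weighted lattice solution on `[0,s]` is an exact pseudo-flow on `[0,s]`.** For admissible
weights with decay constant `D` and bounded structure constants, a solution `T` of `T' = F(T)` on
`[0,s]`, `0 < s`, gives in the variables `S_{i,k}(t) = T(t)_{i,k}/w_k` an exact (`κ₁ = κ₂ = 0`, zero slack,
energies `½S²`) `PseudoFlowOn` on `[0,s]` from `S(0)`.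
[cite: Tao2016AveragedNS, §4 Lemma 4.1 (4.5), (4.8)–(4.10), (4.12)] -/
theorem htcWS_pseudoFlowOn_of_solution {m : ℕ} {ε₀ A Mα D : ℝ}
    {α : Fin m → Fin m → Fin m → ℤ × ℤ × ℤ → ℝ} {w : ℤ → ℝ}
    (hε : 0 ≤ 1 + ε₀) (hw : WeightRatiosLE ε₀ w A) (hMα : 0 ≤ Mα)
    (hα : ∀ i₁ i₂ i₃ μ, |α i₁ i₂ i₃ μ| ≤ Mα)
    (hD : ∀ k : ℤ, (1 + (1 + ε₀) ^ ((10 : ℝ) * k)) / w k ≤ D) {s : ℝ} (hs : 0 < s)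
    (T : ℝ → (Fin m × ℤ →ᵇ ℝ))
    (hT : ∀ t ∈ Icc 0 s, HasDerivWithinAt T (weightedField hε hw hMα hα (T t)) (Icc 0 s) t) :
    PseudoFlowOn s ε₀ α 0 0 (fun i k => T 0 (i, k) / w k)
      (fun i k => (1 / 2) * (T 0 (i, k) / w k) ^ 2) (fun _ _ => 0)
      (fun i k t => T t (i, k) / w k) (fun i k t => (1 / 2) * (T t (i, k) / w k) ^ 2) := by
  obtain ⟨hwpos, hrat⟩ := hw
  set F := weightedField hε ⟨hwpos, hrat⟩ hMα hα with hF
  -- a bound along the window (compactness)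
  have hTcont : ContinuousOn T (Icc 0 s) := fun t ht => (hT t ht).continuousWithinAt
  obtain ⟨C, hC⟩ := isCompact_Icc.exists_bound_of_continuousOn hTcont
  set B := max C 0 with hBdef
  have hB0 : 0 ≤ B := le_max_right _ _
  have hTB : ∀ t ∈ Icc 0 s, ‖T t‖ ≤ B := fun t ht => (hC t ht).trans (le_max_left _ _)
  have hD0 : 0 ≤ D := le_trans (div_nonneg (by positivity) (hwpos 0).le) (hD 0)
  -- coordinates: derivative within `[0,s]`
  have hcoord : ∀ (i : Fin m) (k : ℤ), ∀ t ∈ Icc 0 s,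
      HasDerivWithinAt (fun r => T r (i, k) / w k)
        (quadTerm ε₀ α (fun j n (_ : ℝ) => T t (j, n) / w n) i k 0) (Icc 0 s) t := by
    intro i k t ht
    have h0 := ((BoundedContinuousFunction.evalCLM ℝ (i, k) :
        (Fin m × ℤ →ᵇ ℝ) →L[ℝ] ℝ).hasFDerivAt).comp_hasDerivWithinAt t (hT t ht)
    have h1 : HasDerivWithinAt (fun r => T r (i, k)) (F (T t) (i, k)) (Icc 0 s) t := by
      simpa [Function.comp_def] using h0
    have h2 := h1.div_const (w k)
    rw [hF, weightedField_apply, mul_div_cancel_left₀ _ (hwpos k).ne'] at h2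
    exact h2
  -- the nonlinearity along the family is the nonlinearity of the frozen state
  have hqt : ∀ (i : Fin m) (k : ℤ) (t : ℝ),
      quadTerm ε₀ α (fun j n r => T r (j, n) / w n) i k t =
        quadTerm ε₀ α (fun j n (_ : ℝ) => T t (j, n) / w n) i k 0 := fun i k t => rfl
  have hrhs_cont : ∀ (i : Fin m) (k : ℤ),
      ContinuousOn (fun t => quadTerm ε₀ α (fun j n (_ : ℝ) => T t (j, n) / w n) i k 0) (Icc 0 s) := by
    intro i k
    have hc' : ∀ (j : Fin m) (n : ℤ), ContinuousOn (fun t => T t (j, n) / w n) (Icc 0 s) :=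
      fun j n => (((BoundedContinuousFunction.evalCLM ℝ (j, n) :
        (Fin m × ℤ →ᵇ ℝ) →L[ℝ] ℝ).continuous).comp_continuousOn hTcont).div_const _
    simp only [quadTerm]
    refine continuousOn_finsetSum _ fun i₁ _ => continuousOn_finsetSum _ fun i₂ _ =>
      continuousOn_finsetSum _ fun μ _ => ?_
    exact (continuousOn_const.mul ((hc' _ _).mul (hc' _ _)))
  have hcT : ∀ (i : Fin m) (k : ℤ), ContinuousOn (fun t => T t (i, k) / w k) (Icc 0 s) :=
    fun i k => (((BoundedContinuousFunction.evalCLM ℝ (i, k) :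
      (Fin m × ℤ →ᵇ ℝ) →L[ℝ] ℝ).continuous).comp_continuousOn hTcont).div_const _
  -- the amplitude bound in unweighted variables
  have hamp : ∀ t ∈ Icc 0 s, ∀ (i : Fin m) (k : ℤ), |T t (i, k) / w k| ≤ B / w k := by
    intro t ht i k
    rw [abs_div, abs_of_pos (hwpos k)]
    exact div_le_div_of_nonneg_right
      (((Real.norm_eq_abs _).symm.le.trans ((T t).norm_coe_le_norm (i, k))).trans (hTB t ht))
      (hwpos k).le
  refine
    { contDiffOn_S := fun i k => htcWS_contDiffOn_one_Icc hs (hcoord i k) (hrhs_cont i k)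
      contDiffOn_F := fun i k => ?_
      nonneg_F := fun i k t _ => by positivity
      apriori_S := ⟨D * B, fun t ht i k => ?_⟩
      apriori_F := ⟨D * B, fun t ht i k => ?_⟩
      init_S := fun i k => rfl
      init_F := fun i k => rfl
      motion := fun i k t ht => by
        rw [(hcoord i k t ht).derivWithin (uniqueDiffOn_Icc hs t ht), hqt]
        simp
      energy := fun i k t ht => by
        have h := ((hcoord i k t ht).pow 2).const_mul (1 / 2 : ℝ)
        have h' : HasDerivWithinAt (fun r => (1 / 2) * (T r (i, k) / w k) ^ 2)
            (quadTerm ε₀ α (fun j n (_ : ℝ) => T t (j, n) / w n) i k 0 * (T t (i, k) / w k))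
            (Icc 0 s) t :=
          h.congr_deriv (by rw [show (2 : ℕ) - 1 = 1 from rfl, pow_one, Nat.cast_ofNat]; ring)
        rw [h'.derivWithin (uniqueDiffOn_Icc hs t ht), hqt]
      defect_lower := fun i k t _ => le_rfl
      defect_upper := fun i k t _ => by simp }
  · -- `F = ½ S²` is `C¹`
    have h2 : ∀ t ∈ Icc 0 s, HasDerivWithinAt (fun r => (1 / 2) * (T r (i, k) / w k) ^ 2)
        ((1 / 2) * (↑(2 : ℕ) * (T t (i, k) / w k) ^ (2 - 1) *
          quadTerm ε₀ α (fun j n (_ : ℝ) => T t (j, n) / w n) i k 0)) (Icc 0 s) t :=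
      fun t ht => ((hcoord i k t ht).pow 2).const_mul (1 / 2 : ℝ)
    refine htcWS_contDiffOn_one_Icc hs h2 ?_
    exact continuousOn_const.mul ((continuousOn_const.mul ((hcT i k).pow _)).mul (hrhs_cont i k))
  · -- a priori bound on the amplitudes
    have hpow : 0 ≤ 1 + (1 + ε₀) ^ ((10 : ℝ) * k) := by positivity
    calc (1 + (1 + ε₀) ^ ((10 : ℝ) * k)) * |T t (i, k) / w k|
        ≤ (1 + (1 + ε₀) ^ ((10 : ℝ) * k)) * (B / w k) := mul_le_mul_of_nonneg_left (hamp t ht i k) hpow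
      _ = (1 + (1 + ε₀) ^ ((10 : ℝ) * k)) / w k * B := by ring
      _ ≤ D * B := mul_le_mul_of_nonneg_right (hD k) hB0
  · -- a priori bound on the energies
    have hpow : 0 ≤ 1 + (1 + ε₀) ^ ((10 : ℝ) * k) := by positivity
    have hsq : Real.sqrt ((1 / 2) * (T t (i, k) / w k) ^ 2) ≤ |T t (i, k) / w k| :=
      calc Real.sqrt ((1 / 2 : ℝ) * (T t (i, k) / w k) ^ 2) ≤ Real.sqrt ((T t (i, k) / w k) ^ 2) :=
            Real.sqrt_le_sqrt (by nlinarith [sq_nonneg (T t (i, k) / w k)])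
        _ = |T t (i, k) / w k| := Real.sqrt_sq_eq_abs _
    calc (1 + (1 + ε₀) ^ ((10 : ℝ) * k)) * Real.sqrt ((1 / 2) * (T t (i, k) / w k) ^ 2)
        ≤ (1 + (1 + ε₀) ^ ((10 : ℝ) * k)) * (B / w k) :=
          mul_le_mul_of_nonneg_left (hsq.trans (hamp t ht i k)) hpow
      _ = (1 + (1 + ε₀) ^ ((10 : ℝ) * k)) / w k * B := by ring
      _ ≤ D * B := mul_le_mul_of_nonneg_right (hD k) hB0

/-- Bookkeeping in the other direction: a uniform weighted amplitude bound `w_k |T_{i,k}/w_k| ≤ B`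
(`0 ≤ B`) is the sup-norm bound `‖T‖ ≤ B`. [folklore] -/
theorem htcWS_norm_le_of_weighted_bound {m : ℕ} {w : ℤ → ℝ} (hwpos : ∀ k, 0 < w k)
    (T : Fin m × ℤ →ᵇ ℝ) {B : ℝ} (hB : 0 ≤ B)
    (h : ∀ (i : Fin m) (k : ℤ), w k * |T (i, k) / w k| ≤ B) : ‖T‖ ≤ B := by
  refine (norm_le hB).2 fun p => ?_
  obtain ⟨i, k⟩ := p
  have h1 := h i k
  rw [abs_div, abs_of_pos (hwpos k), mul_div_cancel₀ _ (hwpos k).ne'] at h1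
  rwa [Real.norm_eq_abs]

end Summit.NavierStokesRegularity.NavierStokesRegularity.Theorems

end
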